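import Mathlib.CategoryTheory.Category.Basic
import Mathlib.CategoryTheory.Functor.Basic
import Mathlib.Data.PNat.Basic
import Mathlib.Algebra.Group.Subgroup.Basic
import Mathlib.Tactic.Ring
import Mathlib.Tactic.Linarith
import Mathlib.Tactic.LinearCombination
import Mathlib.Tactic.Positivity
import Mathlib.Tactic.Module
import Literature.AlgebraicGeometry.Frobenioids.ElementaryFrobenioid
import HarnessLib

/-!
# Frobenioids I, §4: Example 4.6 (Frobenius-normalized vs. birationally Frobenius-normalized)

Mochizuki, *The geometry of Frobenioids I: the general theory*, Kyushu J. Math. **62** (2008)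
293–400, kurims text pp. 86–87 [cite: MochizukiFrdI2008, Ex. 4.6 pp.86-87]: "it is not necessarily
the case that a Frobenioid of Frobenius-normalized type is of birationally Frobenius-normalized type".

**Data (DEFINED, laws PROVED).** `G` an abelian group; the module `M := G × ℤ × ℤ`; the commuting
endomorphisms `α_p(g, a, b) = (p·g + a·ξ_p, p·a, p·b)` and the resulting action `n ↦ α_n` of `N_{≥1}`
on `M`; the monoid `N` on `M × N_{≥1}`, `(κ, l) · (μ, m) = (κ + α_l(μ), l·m)`; the category `C` with
objects `A_n`, `n ∈ ℤ`, and `Hom(A_{n₁}, A_{n₂}) = {(g, a, b, d) ∈ N | a, b ≥ 0, n₂ − d·n₁ = a + b}`,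
composition = product in `N`; the functor `C → F_Φ`, `(g, a, b, d) ↦ (a, b, d)`, over the
one-morphism base `D` with `Φ ≡ ℤ_{≥0} × ℤ_{≥0}` (found's `constMonoidOn`, `ElemFrobenioid`); the
subgroup `M₀ = {a + b = 0} ⊆ M`.
**Rendering note.** The family `(ξ_p)_{p prime}` enters `α_n` only through the function
`Ξ(n) = Σ_p v_p(n)·(n/p)·ξ_p` (so that `α_n(g, a, b) = (n·g + a·Ξ(n), n·a, n·b)`), which is exactly a
function `N_{≥1} → G` with `Ξ(mn) = m·Ξ(n) + n·Ξ(m)`; we record the datum in this equivalent form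
(`Datum.Ξ`, `Datum.leibniz`; `ξ_p = Ξ(p)`), the elementary passage `(ξ_p) ↦ Ξ` being omitted.
**PROVED:** `α` is an action (`α_mul`, `α_one`, hence the `α_p` commute); `N` is a monoid; `C` is a
category; `C → F_Φ` is a functor; "`A₀` … for every `A ∈ Ob(C)`, `O^×(A) = O^▷(A) = G`" in the
concrete form "an endomorphism of `A_n` of Frobenius degree `1` has `a = b = 0`, and every `g ∈ G`
occurs" (`endo_degOne_iff`); `α_n` preserves `M₀` ("an action of `N_{≥1}` on … `M₀`, which …
coincide[s] with the restriction to `M₀` of the original action").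
**Deliberately NOT here** (need [FrdI] Def. 1.2/1.3, §4 Prop. 4.4/Def. 4.5 — seats found/t3): "`C` is
a Frobenioid of isotropic and standard type which is not of group-like type", "`A₀` is
Frobenius-trivial", "`O^×(A^birat) = M₀`", "`C` is of [strictly] rational type", "every object of
`(C^un-tr)^birat` is Frobenius-compact", "if the `ξ_p ≠ 0` … `C` fails to be of birationally
Frobenius-normalized type".  No statement of the paper is strengthened.
-/

namespace Literature.AlgebraicGeometry.Frobenioids

open CategoryTheory

namespace Ex46

variable {G : Type} [AddCommGroup G]

variable (G) in
/-- The datum of Ex. 4.6: an abelian group `G` and elements `ξ_p ∈ G`, `p` prime, recorded through the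
function `Ξ : N_{≥1} → G`, `Ξ(n) = Σ_p v_p(n)(n/p) ξ_p` (so `ξ_p = Ξ(p)`), characterised by
`Ξ(mn) = m·Ξ(n) + n·Ξ(m)` (FrdI p. 86; see the rendering note in the module docstring).
[cite: MochizukiFrdI2008, Ex. 4.6 p.86] -/
structure Datum : Type where
  /-- `Ξ(n)`, the `G`-coefficient of `a` in `α_n` -/
  Ξ : ℕ+ → G
  /-- the Leibniz rule `Ξ(mn) = m·Ξ(n) + n·Ξ(m)` -/
  leibniz : ∀ m n : ℕ+, Ξ (m * n) = (m : ℤ) • Ξ n + (n : ℤ) • Ξ m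

variable (P : Datum G)

/-- `Ξ(1) = 0`. [cite: MochizukiFrdI2008, Ex. 4.6 p.86] -/
theorem Datum.Ξ_one : P.Ξ 1 = 0 := by
  have h := P.leibniz 1 1
  simp only [mul_one, PNat.one_coe, Nat.cast_one, one_smul] at h
  -- `h : Ξ 1 = Ξ 1 + Ξ 1`
  have h2 : P.Ξ 1 + P.Ξ 1 = P.Ξ 1 + 0 := by rw [add_zero]; exact h.symm
  exact add_left_cancel h2

variable (G) in
/-- The module `M := G × ℤ × ℤ` (FrdI p. 86). [cite: MochizukiFrdI2008, Ex. 4.6 p.86] -/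
abbrev Mmod : Type := G × ℤ × ℤ

/-- `α_n ∈ End(M)`: `(g, a, b) ↦ (n·g + a·Ξ(n), n·a, n·b)`; for `n = p` prime this is the printed
`α_p(g, a, b) = (p·g + a·ξ_p, p·a, p·b)` (FrdI p. 86). [cite: MochizukiFrdI2008, Ex. 4.6 p.86] -/
def Datum.α (n : ℕ+) : Mmod G →+ Mmod G where
  toFun x := ((n : ℤ) • x.1 + x.2.1 • P.Ξ n, (n : ℤ) * x.2.1, (n : ℤ) * x.2.2)
  map_zero' := by simp
  map_add' x y := by
    refine Prod.ext ?_ (Prod.ext ?_ ?_)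
    · show (n : ℤ) • (x.1 + y.1) + (x.2.1 + y.2.1) • P.Ξ n =
        ((n : ℤ) • x.1 + x.2.1 • P.Ξ n) + ((n : ℤ) • y.1 + y.2.1 • P.Ξ n)
      rw [smul_add, add_smul]; abel
    · show (n : ℤ) * (x.2.1 + y.2.1) = (n : ℤ) * x.2.1 + (n : ℤ) * y.2.1
      exact mul_add _ _ _
    · show (n : ℤ) * (x.2.2 + y.2.2) = (n : ℤ) * x.2.2 + (n : ℤ) * y.2.2
      exact mul_add _ _ _

/-- Values of `α_n`. [cite: MochizukiFrdI2008, Ex. 4.6 p.86] -/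
@[simp] theorem Datum.α_apply (n : ℕ+) (x : Mmod G) :
    P.α n x = ((n : ℤ) • x.1 + x.2.1 • P.Ξ n, (n : ℤ) * x.2.1, (n : ℤ) * x.2.2) := rfl

/-- "Thus, we obtain a homomorphism `N_{≥1} → End(M)`, i.e., an action of `N_{≥1}` on `M`"
(FrdI p. 86; PROVED: `α_{mn} = α_m ∘ α_n`). [cite: MochizukiFrdI2008, Ex. 4.6 p.86] -/
theorem Datum.α_mul (m n : ℕ+) : P.α (m * n) = (P.α m).comp (P.α n) := by
  refine AddMonoidHom.ext fun x => Prod.ext ?_ (Prod.ext ?_ ?_)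
  · show ((m * n : ℕ+) : ℤ) • x.1 + x.2.1 • P.Ξ (m * n) =
      (m : ℤ) • ((n : ℤ) • x.1 + x.2.1 • P.Ξ n) + ((n : ℤ) * x.2.1) • P.Ξ m
    rw [P.leibniz, PNat.mul_coe, Nat.cast_mul]
    module
  · show ((m * n : ℕ+) : ℤ) * x.2.1 = (m : ℤ) * ((n : ℤ) * x.2.1)
    rw [PNat.mul_coe, Nat.cast_mul, mul_assoc]
  · show ((m * n : ℕ+) : ℤ) * x.2.2 = (m : ℤ) * ((n : ℤ) * x.2.2)
    rw [PNat.mul_coe, Nat.cast_mul, mul_assoc]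

/-- `α_1 = id`. [cite: MochizukiFrdI2008, Ex. 4.6 p.86] -/
theorem Datum.α_one : P.α 1 = AddMonoidHom.id _ := by
  refine AddMonoidHom.ext fun x => Prod.ext ?_ (Prod.ext ?_ ?_) <;> simp [P.Ξ_one]

/-- "`α_p` commutes with all `α_{p'}`" (FrdI p. 86; PROVED for all `α_m`, `α_n`).
[cite: MochizukiFrdI2008, Ex. 4.6 p.86] -/
theorem Datum.α_comm (m n : ℕ+) : (P.α m).comp (P.α n) = (P.α n).comp (P.α m) := by
  rw [← Datum.α_mul, ← Datum.α_mul, mul_comm]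

/-- The monoid `N`: underlying set `M × N_{≥1}` (FrdI pp. 86–87). [cite: MochizukiFrdI2008, Ex. 4.6 p.86] -/
@[ext] structure N (P : Datum G) : Type where
  /-- `μ ∈ M` -/
  μ : Mmod G
  /-- `m ∈ N_{≥1}` -/
  d : ℕ+

namespace N

/-- "(λ, l) · (μ, m) = (λ + α_l(μ), l·m)" (FrdI p. 87) is a monoid structure (PROVED).
[cite: MochizukiFrdI2008, Ex. 4.6 p.87] -/
instance instMonoid : Monoid (N P) where
  mul x y := ⟨x.μ + P.α x.d y.μ, x.d * y.d⟩
  one := ⟨0, 1⟩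
  mul_assoc x y z := by
    refine N.ext ?_ (mul_assoc _ _ _)
    show x.μ + P.α x.d y.μ + P.α (x.d * y.d) z.μ = x.μ + P.α x.d (y.μ + P.α y.d z.μ)
    rw [Datum.α_mul, map_add, AddMonoidHom.comp_apply, add_assoc]
  one_mul x := by
    refine N.ext ?_ (one_mul _)
    show 0 + P.α 1 x.μ = x.μ
    rw [Datum.α_one, zero_add]; rfl
  mul_one x := by
    refine N.ext ?_ (mul_one _)
    show x.μ + P.α x.d 0 = x.μ
    rw [map_zero, add_zero]

variable {P}

/-- Components of the product. [cite: MochizukiFrdI2008, Ex. 4.6 p.87] -/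
@[simp] theorem mul_μ (x y : N P) : (x * y).μ = x.μ + P.α x.d y.μ := rfl
/-- Components of the product. [cite: MochizukiFrdI2008, Ex. 4.6 p.87] -/
@[simp] theorem mul_d (x y : N P) : (x * y).d = x.d * y.d := rfl
/-- The unit. [cite: MochizukiFrdI2008, Ex. 4.6 p.87] -/
@[simp] theorem one_μ : (1 : N P).μ = 0 := rfl
/-- The unit. [cite: MochizukiFrdI2008, Ex. 4.6 p.87] -/
@[simp] theorem one_d : (1 : N P).d = 1 := rfl

end N

/-- The `a`-coordinate of `x = ((g, a, b), d) ∈ N`. [cite: MochizukiFrdI2008, Ex. 4.6 p.87] -/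
abbrev N.a (x : N P) : ℤ := x.μ.2.1

/-- The `b`-coordinate of `x = ((g, a, b), d) ∈ N`. [cite: MochizukiFrdI2008, Ex. 4.6 p.87] -/
abbrev N.b (x : N P) : ℤ := x.μ.2.2

/-- Coordinates of a product: `a(x·y) = a_x + d_x a_y`. [cite: MochizukiFrdI2008, Ex. 4.6 p.87] -/
theorem N.mul_a (x y : N P) : (x * y).a = x.a + (x.d : ℤ) * y.a := rfl

/-- Coordinates of a product: `b(x·y) = b_x + d_x b_y`. [cite: MochizukiFrdI2008, Ex. 4.6 p.87] -/
theorem N.mul_b (x y : N P) : (x * y).b = x.b + (x.d : ℤ) * y.b := rfl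

/-- The objects `A_n`, `n ∈ ℤ`, of `C` (FrdI p. 87). [cite: MochizukiFrdI2008, Ex. 4.6 p.87] -/
structure Obj (P : Datum G) : Type where
  /-- the index `n ∈ ℤ` of `A_n` -/
  idx : ℤ

/-- `Hom(A_{n₁}, A_{n₂})`: "elements `(g, a, b, d) ∈ N` such that `a ≥ 0`, `b ≥ 0`, `n₂ − d·n₁ = a + b`"
(FrdI p. 87). [cite: MochizukiFrdI2008, Ex. 4.6 p.87] -/
def HomSet (A B : Obj P) : Type :=
  {x : N P // 0 ≤ x.a ∧ 0 ≤ x.b ∧ B.idx - (x.d : ℤ) * A.idx = x.a + x.b}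

/-- `C` is a category: "composition of morphisms is determined by the product structure of `N`"
(FrdI p. 87; closure under composition PROVED). [cite: MochizukiFrdI2008, Ex. 4.6 p.87] -/
instance instCategory : Category (Obj P) where
  Hom := HomSet P
  id A := ⟨1, le_rfl, le_rfl, by show A.idx - (((1 : ℕ+) : ℕ) : ℤ) * A.idx = (0 : ℤ) + 0; simp⟩
  comp {A B C'} x y := ⟨y.1 * x.1, by
    obtain ⟨hxa, hxb, hx⟩ := x.2
    obtain ⟨hya, hyb, hy⟩ := y.2
    refine ⟨?_, ?_, ?_⟩
    · rw [N.mul_a]; positivity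
    · rw [N.mul_b]; positivity
    · rw [N.mul_a, N.mul_b, N.mul_d, PNat.mul_coe, Nat.cast_mul]
      linear_combination hy + (y.1.d : ℤ) * hx⟩
  id_comp x := Subtype.ext (mul_one _)
  comp_id x := Subtype.ext (one_mul _)
  assoc x y z := Subtype.ext (mul_assoc _ _ _).symm

/-- The element of `N` underlying a morphism of `C`. [cite: MochizukiFrdI2008, Ex. 4.6 p.87] -/
abbrev val {A B : Obj P} (x : A ⟶ B) : N P := x.1

/-- Composition in `C` is the product in `N` (in the order "second ∘ first"). [cite: MochizukiFrdI2008, Ex. 4.6 p.87] -/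
@[simp] theorem val_comp {A B C' : Obj P} (x : A ⟶ B) (y : B ⟶ C') : val P (x ≫ y) = val P y * val P x := rfl

/-- The identity of `A_n` is `1 ∈ N`. [cite: MochizukiFrdI2008, Ex. 4.6 p.87] -/
@[simp] theorem val_id (A : Obj P) : val P (𝟙 A) = 1 := rfl

/-- `D` is a one-morphism category and "`Φ` the monoid on `D` whose unique value is given by
`ℤ_{≥0} × ℤ_{≥0}`" (FrdI p. 87; found's `constMonoidOn`). [cite: MochizukiFrdI2008, Ex. 4.6 p.87] -/
abbrev Φ := constMonoidOn (Multiplicative (ℕ × ℕ))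

/-- Arithmetic of `Int.toNat` on the nonnegative coordinates. [cite: MochizukiFrdI2008, Ex. 4.6 p.87] -/
private theorem toNat_add_mul {a b : ℤ} (d : ℕ) (ha : 0 ≤ a) (hb : 0 ≤ b) :
    (a + d * b).toNat = a.toNat + d * b.toNat := by
  obtain ⟨a', rfl⟩ := Int.eq_ofNat_of_zero_le ha
  obtain ⟨b', rfl⟩ := Int.eq_ofNat_of_zero_le hb
  have h : ((a' : ℤ) + (d : ℤ) * b') = ((a' + d * b' : ℕ) : ℤ) := by push_cast; ring
  rw [h, Int.toNat_natCast, Int.toNat_natCast, Int.toNat_natCast]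

/-- The divisor coordinate of a composite, computed in `ℤ_{≥0} × ℤ_{≥0}` (written multiplicatively):
`(a, b)(y·x) = (a, b)(y) + d_y · (a, b)(x)`. [cite: MochizukiFrdI2008, Ex. 4.6 p.87] -/
private theorem div_comp_aux (x y : N P) (hxa : 0 ≤ x.a) (hxb : 0 ≤ x.b) (hya : 0 ≤ y.a) (hyb : 0 ≤ y.b) :
    Multiplicative.ofAdd ((y * x).a.toNat, (y * x).b.toNat) =
      Multiplicative.ofAdd (y.a.toNat, y.b.toNat) *
        Multiplicative.ofAdd (x.a.toNat, x.b.toNat) ^ (y.d : ℕ) := by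
  rw [← ofAdd_nsmul, ← ofAdd_add, N.mul_a, N.mul_b, toNat_add_mul _ hya hxa, toNat_add_mul _ hyb hxb]
  rfl

/-- "The assignment `(g, a, b, d) ↦ (a, b, d)` then determines a functor `C → F_Φ` [which lies over
`D`]" (FrdI p. 87; PROVED). [cite: MochizukiFrdI2008, Ex. 4.6 p.87] -/
def toElem : Obj P ⥤ ElemFrobenioid Φ where
  obj _ := ElemFrobenioid.of Φ (Discrete.mk PUnit.unit)
  map x := ElemFrobenioid.homMk (𝟙 _)
    (Multiplicative.ofAdd ((val P x).a.toNat, (val P x).b.toNat)) (val P x).d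
  map_id A := ElemFrobenioid.Hom.ext rfl rfl rfl
  map_comp {A B C'} x y := by
    obtain ⟨hxa, hxb, -⟩ := x.2
    obtain ⟨hya, hyb, -⟩ := y.2
    exact ElemFrobenioid.Hom.ext (Subsingleton.elim _ _) (div_comp_aux P (val P x) (val P y) hxa hxb hya hyb)
      (mul_comm _ _)

/-- The object `A₀` (FrdI p. 87: "`A₀ ∈ Ob(C)` is Frobenius-trivial"). [cite: MochizukiFrdI2008, Ex. 4.6 p.87] -/
def A₀ : Obj P := ⟨0⟩

/-- "for every `A ∈ Ob(C)`, `O^×(A) = O^▷(A) = G`" (FrdI p. 87), in concrete form (PROVED): an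
endomorphism of `A_n` of Frobenius degree `1` has `a = b = 0` — so it is `((g, 0, 0), 1)` for a unique
`g ∈ G` — and every `g ∈ G` so occurs. [cite: MochizukiFrdI2008, Ex. 4.6 p.87] -/
theorem endo_degOne_iff (A : Obj P) (x : N P) :
    (∃ f : A ⟶ A, val P f = x ∧ x.d = 1) ↔ ∃ g : G, x = ⟨(g, 0, 0), 1⟩ := by
  constructor
  · rintro ⟨f, rfl, hd⟩
    obtain ⟨ha, hb, h⟩ := f.2
    rw [hd, PNat.one_coe, Nat.cast_one, one_mul, sub_self] at h
    have ha0 : (val P f).a = 0 := by linarith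
    have hb0 : (val P f).b = 0 := by linarith
    refine ⟨(val P f).μ.1, N.ext (Prod.ext rfl (Prod.ext ha0 hb0)) hd⟩
  · rintro ⟨g, rfl⟩
    exact ⟨⟨⟨(g, 0, 0), 1⟩, le_rfl, le_rfl, by simp⟩, rfl, rfl⟩

/-- `M₀ ⊆ M`: "the subgroup of `(g, a, b) ∈ M` such that `a + b = 0`" (FrdI p. 87: `O^×(A^birat) = M₀`).
[cite: MochizukiFrdI2008, Ex. 4.6 p.87] -/
def M₀ : AddSubgroup (Mmod G) where
  carrier := {x | x.2.1 + x.2.2 = 0}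
  add_mem' {x y} hx hy := by
    simp only [Set.mem_setOf_eq, Prod.fst_add, Prod.snd_add] at *
    omega
  zero_mem' := by simp
  neg_mem' {x} hx := by
    simp only [Set.mem_setOf_eq, Prod.fst_neg, Prod.snd_neg] at *
    omega

/-- The action of `N_{≥1}` on `M` preserves `M₀` ("an action of `N_{≥1}` on `O^×(A^birat) = M₀`, which
is easily verified to coincide with the restriction to `M₀` of the original action of `N_{≥1}` on `M`",
FrdI p. 87; the preservation is PROVED). [cite: MochizukiFrdI2008, Ex. 4.6 p.87] -/
theorem α_mem_M₀ (n : ℕ+) {x : Mmod G} (hx : x ∈ M₀) : P.α n x ∈ M₀ := by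
  change x.2.1 + x.2.2 = 0 at hx
  show (n : ℤ) * x.2.1 + (n : ℤ) * x.2.2 = 0
  rw [← mul_add, hx, mul_zero]

end Ex46

end Literature.AlgebraicGeometry.Frobenioids
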